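import Summits.QuantumFields.YangMills.Theorems.UnitScaleTiltProp7CovOfThm2
import HarnessLib

/-!
# Route `UnitScaleTilt`, crux K1 child «MinimiserStabilityRegPr» (stmt-QuantumFields-19200), stub EX (`stub_existenceMinimalOrbit`), the LAST displayed analytic
# letter `hThm2S` of the EX display of record S53 (✓p781947) — **WHAT EX CONSUMES OF [Balaban1985RegularSpaces] THEOREM 2, BY KERNEL: the EXISTENCE half
# at the TOP averaging level only, Hölder-free, (1.37)-free, uniqueness-free («hT2top»), already gives COV** (and hence EX modulo C-min ∕ the chart rows,
# through the unchanged door ✓`Prop7CovOfThm2.cov_of_thm2`)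

Cell `ym3-torus` (HUMAN RULING D-0037, YM ladder rung R3 — SU(2) YM₃ on T³: NOT d = 4, NOT infinite volume, NOT a mass gap, NOT Clay).  Width seat `ym3-torus-px12`
(gen 19), count-neutral LOCATE «hThm2S — what EX consumes» for the post-freeze docket item (5) «`hThm2S` road» (★★OWNER g37 § FINAL); THEOREMS ONLY (0 `def`,
0 `sorry`, default heartbeats); `--supports stmt-QuantumFields-19200 --as helper`; NO claim on crux ∕ stub ∕ registry; nothing of the J-FREEZE (binders ∕
`closes` ∕ items) is touched — the EX display of record S53 and its letter `hThm2S` (in `B8Thm2SetupTorus.Thm2SetupSUAt` currency, ★★OWNER RULING g27-№2) are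
UNCHANGED; this file only records, as a theorem, how much weaker a supplier may be and still feed COV.

THE OBSERVATION.  The EX knit consumes [6] Theorem 2 through exactly one door, ✓`Prop7CovOfThm2.cov_of_thm2` (S3S ∕ S5(E) level: `hThm2S` ⟶
✓`Prop7SPrintThm2Dict.thm2Based_of_thm2SetupSUAt` ⟶ the based-letters row (T2) ⟶ COV ⟶ ✓`in19_of_based136_139`).  Row (T2) asks, per member and per
pair `(U₀, U)`: EXISTENCE of `(u, U₁, A)` with (1.29), `(U₁U₀)^u = U`, `A` self-adjoint, `U₁ = e^{iηA}`, (1.36) as `∃ β₀ B₂ len, C136T …`, (1.38)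
`IsLandau138`, (1.39) `C139T`.  Three remarks, each a one-line proof: (a) `∃ β₀` sits INSIDE, so the (1.36) HÖLDER member `∀ β, 0 ≤ β → β ≤ β₀ → …`
is VACUOUS at `β₀ := −1` (`B₂`, `len` idle); (b) on the all-torus geometry `Ω_j = T_η` the level-`j` clauses `… < B₁s(Lʲη)^{−p}`, `j ≤ k`, all
FOLLOW from the top clause `j = k` (`(Lʲη)⁻¹ ≥ (Lᵏη)⁻¹` for `L ≥ 1`); (c) at the T³ member `Lᵏη = L^{K−n}·L^{−(K−n)} = 1`, so the top clauses are
UNIT-SCALE bounds `‖A‖, ‖∇^η_{U₀}A‖, ‖D^{η*}D^ηA‖, ‖Δ^η_{U₀}A‖ < B₁(α₀ + α₁)`.  Neither (1.37) `C137T` nor the UNIQUENESS clause of Theorem 2 is read by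
the door.  HENCE the letter «hT2top» below — existence of the based Landau representative with four unit-scale sup bounds — implies row (T2) token for
token (`hT2_of_hT2top`) and COV (`cov_of_hT2top`, = ✓`cov_of_thm2` ∘ §2).  For the docket: the displayed `hThm2S` (full Theorem 2: all levels,
Hölder slot, (1.37), uniqueness among (1.29)-restricted `SU(2)` gauges) is STRICTLY STRONGER than what EX uses; a supplier of «hT2top» closes COV by
this file, and closes the DISPLAYED `hThm2S` only after the (cheap) (1.37) algebra and the (not cheap) uniqueness half — which EX never reads.

WHAT IS PROVED (namespace `Summit.QuantumFields.YangMills.Theorems.Prop7CovOfThm2TopLevel`).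
* §1 `inv_pow_mul_le_inv_pow_mul` (`(Lᵏη)⁻¹ ≤ (Lʲη)⁻¹`, `j ≤ k`, `1 ≤ L`, `0 < η`), ★`c136T_of_top` ((1.36) at `β₀ := −1` from its two top clauses),
  ★`c139T_of_top` ((1.39) from its two top clauses); `(F.L)^{K−n}·η = 1` is ✓`Prop7SPrintIn19.pow_mul_eta`, reused by name.
* §2 ★★`hT2_of_hT2top` — row (T2) of ✓`cov_of_thm2` VERBATIM from «hT2top».
* §3 ★★★`cov_of_hT2top` — COV (✓`existenceMinimalOrbit_of_Cmin_cov`'s `hV`, verbatim = ✓`cov_of_thm2`'s conclusion) from «hT2top», every `B₃ ≥ 0`.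
HONEST SCOPE.  Reductions only; [6] Theorem 2 (any half) at a curved background is NOT proved here; «hT2top» is a HYPOTHESIS SHAPE; the displayed
`hThm2S`, EX, the crux 19200, rung R3 are NOT proved; nothing continuum ∕ OS ∕ Clay; the Yang–Mills mass gap is NOT proved.

References: T. Bałaban, CMP **99** (1985) 75–102 [Balaban1985RegularSpaces] (Thm 2 p.83, (1.36)–(1.38) p.82, (1.39) p.83, p.77 «Ω_j = T_η for j = 0,1,…,l, l ≤ k»);
CMP **102** (1985) 277–309 [Balaban1985Variational] ((19)–(21), Prop. 2 p.281).
-/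

set_option autoImplicit false

noncomputable section

namespace Summit.QuantumFields.YangMills.Theorems.Prop7CovOfThm2TopLevel

open scoped Matrix.Norms.L2Operator
open NormedSpace
open Literature.MathematicalPhysics.QuantumFieldTheory.Balaban1983to89
open Literature.MathematicalPhysics.QuantumFieldTheory.Balaban1983to89.T3ContinuumYM3Torus
open Literature.MathematicalPhysics.QuantumFieldTheory.Balaban1983to89.T3PrintedRegularMinimiser (RegPr regFibrePr)
open B7Prop1Explicit renaming Site → LSite
open B8Ineq132 (covDerivFwd)
open B8Eq138LandauZd (IsLandau138 covLap)
open B8Eq143PlaqExpansion (pdiv)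
open B8Eq146AExpansion (plaqCovDeriv)
open B9Eq340HolderZd (hquot AdmPair)
open B8Thm4TorusAt (torusLam)
open B8Thm2TorusAt (C136T C139T Cond135T)
open B10Eq27TorusAxialLog (pull)
open T3SectALandauChart (pert emb15 eta eta_pos bgUnits In19 CloseAvg)
open Summit.QuantumFields.YangMills.Theorems.Prop7SPrint (basePt IsAxialPrint RestrictedPrint AvgCondPrint IsLandauPrint)
open Summit.QuantumFields.YangMills.Theorems.Prop7CovOfThm2 (cov_of_thm2)
open Summit.QuantumFields.YangMills.Theorems.Prop7SPrintIn19 (pow_mul_eta)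

/-! ## §1 The all-torus level clauses follow from the top level; the Hölder slot is vacuous at `β₀ := −1` -/

section Levels

variable {d : ℕ} {𝔸 : Type*} [NormedRing 𝔸] [NormedAlgebra ℂ 𝔸]

/-- `(Lᵏη)⁻¹ ≤ (Lʲη)⁻¹` for `j ≤ k`, `1 ≤ L`, `0 < η`, and the same for every power. [folklore] -/
theorem inv_pow_mul_le_inv_pow_mul {L : ℕ} (hL : 1 ≤ L) {η : ℝ} (hη : 0 < η) {j k : ℕ} (hjk : j ≤ k) (p : ℕ) :
    (((L : ℝ) ^ k * η)⁻¹) ^ p ≤ (((L : ℝ) ^ j * η)⁻¹) ^ p := by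
  have hL1 : (1 : ℝ) ≤ L := by exact_mod_cast hL
  have hj : 0 < (L : ℝ) ^ j * η := mul_pos (pow_pos (lt_of_lt_of_le one_pos hL1) _) hη
  have hk : (L : ℝ) ^ j * η ≤ (L : ℝ) ^ k * η := mul_le_mul_of_nonneg_right (pow_le_pow_right₀ hL1 hjk) hη.le
  exact pow_le_pow_left₀ (inv_nonneg.2 (hj.le.trans hk)) (inv_anti₀ hj hk) p

/-- ★ **(1.36) ON THE ALL-TORUS GEOMETRY FROM ITS TWO TOP CLAUSES, HÖLDER SLOT VACUOUS.**  If the sup and the gradient members hold at the top level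
`j = k`, then `C136T L k η (−1) B₁ B₂ len s U₀ A` for ANY `B₂`, `len` (`0 ≤ B₁s`, `1 ≤ L`, `0 < η`).
[cite: Balaban1985RegularSpaces, (1.36) p.82, p.77 («Ω_j = T_η»)] -/
theorem c136T_of_top {L k : ℕ} (hL : 1 ≤ L) {η : ℝ} (hη : 0 < η) {B₁ s : ℝ} (hBs : 0 ≤ B₁ * s) (B₂ : ℝ) (len : LSite d → ℝ)
    (U₀ : LSite d → Fin d → 𝔸ˣ) (A : LSite d → Fin d → 𝔸)
    (h1 : ∀ (x : LSite d) (μ : Fin d), ‖A x μ‖ < B₁ * s * ((L : ℝ) ^ k * η)⁻¹)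
    (h2 : ∀ (x : LSite d) (μ κ : Fin d), ‖covDerivFwd η U₀ μ (fun z => A z κ) x‖ < B₁ * s * (((L : ℝ) ^ k * η)⁻¹) ^ 2) :
    C136T L k η (-1) B₁ B₂ len s U₀ A := by
  refine ⟨fun j hj x μ => ?_, fun j hj x μ κ => ?_, fun β hβ0 hβ1 => absurd (hβ0.trans hβ1) (by norm_num)⟩
  · have hm := inv_pow_mul_le_inv_pow_mul hL hη hj 1
    simp only [pow_one] at hm
    exact (h1 x μ).trans_le (mul_le_mul_of_nonneg_left hm hBs)
  · exact (h2 x μ κ).trans_le (mul_le_mul_of_nonneg_left (inv_pow_mul_le_inv_pow_mul hL hη hj 2) hBs)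

/-- ★ **(1.39) ON THE ALL-TORUS GEOMETRY FROM ITS TWO TOP CLAUSES.** [cite: Balaban1985RegularSpaces, (1.39) p.83, p.77 («Ω_j = T_η»)] -/
theorem c139T_of_top {L k : ℕ} (hL : 1 ≤ L) {η : ℝ} (hη : 0 < η) {B₁ s : ℝ} (hBs : 0 ≤ B₁ * s)
    (U₀ : LSite d → Fin d → 𝔸ˣ) (A : LSite d → Fin d → 𝔸)
    (h1 : ∀ (x : LSite d) (μ : Fin d), ‖pdiv η U₀ (plaqCovDeriv η U₀ A) μ x‖ < B₁ * s * (((L : ℝ) ^ k * η)⁻¹) ^ 3)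
    (h2 : ∀ (x : LSite d) (κ : Fin d), ‖covLap η U₀ (fun z => A z κ) x‖ < B₁ * s * (((L : ℝ) ^ k * η)⁻¹) ^ 3) :
    C139T L k η B₁ s U₀ A :=
  ⟨fun _ hj x μ => (h1 x μ).trans_le (mul_le_mul_of_nonneg_left (inv_pow_mul_le_inv_pow_mul hL hη hj 3) hBs),
    fun _ hj x κ => (h2 x κ).trans_le (mul_le_mul_of_nonneg_left (inv_pow_mul_le_inv_pow_mul hL hη hj 3) hBs)⟩

end Levels

/-! ## §2 Row (T2) of ✓`cov_of_thm2` from the top-level existence half «hT2top» -/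

variable {L : ℕ}

/-- ★★ **ROW (T2) FROM «hT2top».**  «hT2top» = per member (`F.L = L`, `n < K`) and per based pair: for `0 < α₀, α₁`, `α₀ + α₁ ≤ c₁`, `U₀, U ∈ 𝔘(α₀)`
(`RegPr`), `U` in the based axial gauge of `U₀`, (1.35) at level `K − n`, THERE EXIST a (1.29)-restricted `u`, `U₁` and a self-adjoint `A` with
`(U₁U₀)^u = U`, `U₁ = e^{iηA}`, the Landau condition (1.38), and the four UNIT-SCALE sup bounds `‖A♯‖, ‖∇^η_{U₀♯}A♯‖, ‖D^{η*}D^ηA♯‖, ‖Δ^η_{U₀♯}A♯‖ <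
B₁(α₀ + α₁)` on the pullbacks — NO level index, NO Hölder member, NO (1.37), NO uniqueness.  It implies ✓`cov_of_thm2`'s hypothesis (T2) VERBATIM
(§1 at `β₀ := −1`, `B₂ := 0`, `len := 0`, and ✓`pow_mul_eta`: `Lᵏη = 1`). [cite: Balaban1985RegularSpaces, Thm 2 p.83, (1.36)–(1.38) p.82, (1.39) p.83; Balaban1985Variational, Prop. 2 p.281] -/
theorem hT2_of_hT2top {B₁ c₁ : ℝ} (hB₁ : 0 < B₁)
    (hT2top : ∀ (F : T3Family), F.L = L → ∀ (n K : ℕ), n < K → ∀ (α₀ α₁ : ℝ), 0 < α₀ → 0 < α₁ → α₀ + α₁ ≤ c₁ →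
      ∀ (U₀ U : GaugeField (F.P K) 0 (Matrix.specialUnitaryGroup (Fin 2) ℂ)),
        RegPr F n K α₀ U₀ → RegPr F n K α₀ U → IsAxialPrint F n K U₀ U →
        Cond135T (F.P K).L (K - n) (pull (bgUnits F K U₀) (basePt F n K)) (pull (bgUnits F K (pert U₀ U)) (basePt F n K)) α₁ →
        ∃ (u : GaugeTransf (F.P K) 0 (Matrix.specialUnitaryGroup (Fin 2) ℂ))
          (U₁ : GaugeField (F.P K) 0 (Matrix.specialUnitaryGroup (Fin 2) ℂ)) (A : PBond (F.P K) 0 → Matrix (Fin 2) (Fin 2) ℂ),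
          RestrictedPrint F n K U₀ u ∧ GaugeField.gaugeAct u (emb15 U₀ U₁) = U ∧ (∀ b : PBond (F.P K) 0, IsSelfAdjoint (A b)) ∧
          (∀ b : PBond (F.P K) 0,
            ((U₁ b : Matrix.specialUnitaryGroup (Fin 2) ℂ) : Matrix (Fin 2) (Fin 2) ℂ) = exp (Complex.I • ((eta F n K) • A b))) ∧
          (∀ (x : LSite (F.P K).d) (μ : Fin (F.P K).d), ‖pull A (basePt F n K) x μ‖ < B₁ * (α₀ + α₁)) ∧
          (∀ (x : LSite (F.P K).d) (μ κ : Fin (F.P K).d),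
            ‖covDerivFwd (eta F n K) (pull (bgUnits F K U₀) (basePt F n K)) μ (fun z => pull A (basePt F n K) z κ) x‖ < B₁ * (α₀ + α₁)) ∧
          IsLandau138 (F.P K).L (K - n) (eta F n K) (Set.univ : Set (LSite (F.P K).d)) (torusLam (K - n))
            (pull (bgUnits F K U₀) (basePt F n K)) (pull A (basePt F n K)) ∧
          (∀ (x : LSite (F.P K).d) (μ : Fin (F.P K).d),
            ‖pdiv (eta F n K) (pull (bgUnits F K U₀) (basePt F n K))
                (plaqCovDeriv (eta F n K) (pull (bgUnits F K U₀) (basePt F n K)) (pull A (basePt F n K))) μ x‖ < B₁ * (α₀ + α₁)) ∧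
          (∀ (x : LSite (F.P K).d) (κ : Fin (F.P K).d),
            ‖covLap (eta F n K) (pull (bgUnits F K U₀) (basePt F n K)) (fun z => pull A (basePt F n K) z κ) x‖ < B₁ * (α₀ + α₁))) :
    ∀ (F : T3Family), F.L = L → ∀ (n K : ℕ), n < K → ∀ (α₀ α₁ : ℝ), 0 < α₀ → 0 < α₁ → α₀ + α₁ ≤ c₁ →
      ∀ (U₀ U : GaugeField (F.P K) 0 (Matrix.specialUnitaryGroup (Fin 2) ℂ)),
        RegPr F n K α₀ U₀ → RegPr F n K α₀ U → IsAxialPrint F n K U₀ U →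
        Cond135T (F.P K).L (K - n) (pull (bgUnits F K U₀) (basePt F n K)) (pull (bgUnits F K (pert U₀ U)) (basePt F n K)) α₁ →
        ∃ (u : GaugeTransf (F.P K) 0 (Matrix.specialUnitaryGroup (Fin 2) ℂ))
          (U₁ : GaugeField (F.P K) 0 (Matrix.specialUnitaryGroup (Fin 2) ℂ)) (A : PBond (F.P K) 0 → Matrix (Fin 2) (Fin 2) ℂ),
          RestrictedPrint F n K U₀ u ∧ GaugeField.gaugeAct u (emb15 U₀ U₁) = U ∧ (∀ b : PBond (F.P K) 0, IsSelfAdjoint (A b)) ∧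
          (∀ b : PBond (F.P K) 0,
            ((U₁ b : Matrix.specialUnitaryGroup (Fin 2) ℂ) : Matrix (Fin 2) (Fin 2) ℂ) = exp (Complex.I • ((eta F n K) • A b))) ∧
          (∃ (β₀ B₂ : ℝ) (len : LSite (F.P K).d → ℝ),
            C136T (F.P K).L (K - n) (eta F n K) β₀ B₁ B₂ len (α₀ + α₁) (pull (bgUnits F K U₀) (basePt F n K)) (pull A (basePt F n K))) ∧
          IsLandau138 (F.P K).L (K - n) (eta F n K) (Set.univ : Set (LSite (F.P K).d)) (torusLam (K - n))
            (pull (bgUnits F K U₀) (basePt F n K)) (pull A (basePt F n K)) ∧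
          C139T (F.P K).L (K - n) (eta F n K) B₁ (α₀ + α₁) (pull (bgUnits F K U₀) (basePt F n K)) (pull A (basePt F n K)) := by
  intro F hF n K hnK α₀ α₁ hα₀ hα₁ hc U₀ U h₀ hU hax h35
  obtain ⟨u, U₁, A, h29, hact, hsa, hexp, hsup, hgrad, h38, hdiv, hlap⟩ := hT2top F hF n K hnK α₀ α₁ hα₀ hα₁ hc U₀ U h₀ hU hax h35
  have hL1 : 1 ≤ (F.P K).L := le_of_lt F.hL.2
  have hη := eta_pos F n K
  have hBs : 0 ≤ B₁ * (α₀ + α₁) := by positivity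
  have h1 : ((F.P K).L : ℝ) ^ (K - n) * eta F n K = 1 := pow_mul_eta F n K
  refine ⟨u, U₁, A, h29, hact, hsa, hexp, ⟨-1, 0, fun _ => 0, c136T_of_top hL1 hη hBs 0 _ _ _ ?_ ?_⟩, h38, c139T_of_top hL1 hη hBs _ _ ?_ ?_⟩
  · intro x μ; rw [h1, inv_one, mul_one]; exact hsup x μ
  · intro x μ κ; rw [h1, inv_one, one_pow, mul_one]; exact hgrad x μ κ
  · intro x μ; rw [h1, inv_one, one_pow, mul_one]; exact hdiv x μ
  · intro x κ; rw [h1, inv_one, one_pow, mul_one]; exact hlap x κ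

/-! ## §3 COV from «hT2top» -/

/-- ★★★ **COV FROM «hT2top»** — the criticality-free chart hypothesis COV of route (α) (✓`Prop7ExistRouteAlphaMin.existenceMinimalOrbit_of_Cmin_cov`'s
`hV`, = ✓`cov_of_thm2`'s conclusion VERBATIM) from the top-level, Hölder-free, (1.37)-free, uniqueness-free existence half of [6] Theorem 2 for the
based letters, every `B₃ ≥ 0` (= ✓`cov_of_thm2` ∘ `hT2_of_hT2top`). [cite: Balaban1985RegularSpaces, Thm 2 p.83; Balaban1985Variational, Prop. 2 p.281, (19)–(21) p.281] -/
theorem cov_of_hT2top {B₃ B₁ c₁ : ℝ} (hB₃ : 0 ≤ B₃) (hB₁ : 0 < B₁) (hc₁ : 0 < c₁)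
    (hT2top : ∀ (F : T3Family), F.L = L → ∀ (n K : ℕ), n < K → ∀ (α₀ α₁ : ℝ), 0 < α₀ → 0 < α₁ → α₀ + α₁ ≤ c₁ →
      ∀ (U₀ U : GaugeField (F.P K) 0 (Matrix.specialUnitaryGroup (Fin 2) ℂ)),
        RegPr F n K α₀ U₀ → RegPr F n K α₀ U → IsAxialPrint F n K U₀ U →
        Cond135T (F.P K).L (K - n) (pull (bgUnits F K U₀) (basePt F n K)) (pull (bgUnits F K (pert U₀ U)) (basePt F n K)) α₁ →
        ∃ (u : GaugeTransf (F.P K) 0 (Matrix.specialUnitaryGroup (Fin 2) ℂ))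
          (U₁ : GaugeField (F.P K) 0 (Matrix.specialUnitaryGroup (Fin 2) ℂ)) (A : PBond (F.P K) 0 → Matrix (Fin 2) (Fin 2) ℂ),
          RestrictedPrint F n K U₀ u ∧ GaugeField.gaugeAct u (emb15 U₀ U₁) = U ∧ (∀ b : PBond (F.P K) 0, IsSelfAdjoint (A b)) ∧
          (∀ b : PBond (F.P K) 0,
            ((U₁ b : Matrix.specialUnitaryGroup (Fin 2) ℂ) : Matrix (Fin 2) (Fin 2) ℂ) = exp (Complex.I • ((eta F n K) • A b))) ∧
          (∀ (x : LSite (F.P K).d) (μ : Fin (F.P K).d), ‖pull A (basePt F n K) x μ‖ < B₁ * (α₀ + α₁)) ∧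
          (∀ (x : LSite (F.P K).d) (μ κ : Fin (F.P K).d),
            ‖covDerivFwd (eta F n K) (pull (bgUnits F K U₀) (basePt F n K)) μ (fun z => pull A (basePt F n K) z κ) x‖ < B₁ * (α₀ + α₁)) ∧
          IsLandau138 (F.P K).L (K - n) (eta F n K) (Set.univ : Set (LSite (F.P K).d)) (torusLam (K - n))
            (pull (bgUnits F K U₀) (basePt F n K)) (pull A (basePt F n K)) ∧
          (∀ (x : LSite (F.P K).d) (μ : Fin (F.P K).d),
            ‖pdiv (eta F n K) (pull (bgUnits F K U₀) (basePt F n K))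
                (plaqCovDeriv (eta F n K) (pull (bgUnits F K U₀) (basePt F n K)) (pull A (basePt F n K))) μ x‖ < B₁ * (α₀ + α₁)) ∧
          (∀ (x : LSite (F.P K).d) (κ : Fin (F.P K).d),
            ‖covLap (eta F n K) (pull (bgUnits F K U₀) (basePt F n K)) (fun z => pull A (basePt F n K) z κ) x‖ < B₁ * (α₀ + α₁))) :
    ∃ B₁' c₁' : ℝ, 0 < B₁' ∧ 0 < c₁' ∧ ∀ (F : T3Family) (hF : F.L = L) (n K : ℕ) (hnK : n < K) (ε₀ ε₁ ε₂ : ℝ), 0 < ε₀ → 0 < ε₁ →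
        ε₀ + (L : ℝ) ^ 3 * ε₁ ≤ c₁' → B₁' * (ε₀ + (L : ℝ) ^ 3 * ε₁) ≤ ε₂ →
        ∀ (V : GaugeField (F.P n) 0 (Matrix.specialUnitaryGroup (Fin 2) ℂ)) (U₀ : GaugeField (F.P K) 0 (Matrix.specialUnitaryGroup (Fin 2) ℂ)),
          RegPr F n K ((L : ℝ) ^ 3 * B₃ * ε₁) U₀ → CloseAvg F n K hnK.le ((L : ℝ) ^ 3 * ε₁) V U₀ →
          ∀ U : GaugeField (F.P K) 0 (Matrix.specialUnitaryGroup (Fin 2) ℂ), U ∈ regFibrePr F n K hnK.le ε₀ V → IsAxialPrint F n K U₀ U →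
            ∃ (u : GaugeTransf (F.P K) 0 (Matrix.specialUnitaryGroup (Fin 2) ℂ)) (U₁ : GaugeField (F.P K) 0 (Matrix.specialUnitaryGroup (Fin 2) ℂ))
              (X : PBond (F.P K) 0 → Matrix (Fin 2) (Fin 2) ℂ),
              RestrictedPrint F n K U₀ u ∧ GaugeField.gaugeAct u (emb15 U₀ U₁) = U ∧ In19 F n K ε₂ U₀ U₁ X ∧
                AvgCondPrint F n K hnK.le V U₀ X ∧ IsLandauPrint F n K U₀ X :=
  cov_of_thm2 hB₃ hB₁ hc₁ (hT2_of_hT2top hB₁ hT2top)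

end Summit.QuantumFields.YangMills.Theorems.Prop7CovOfThm2TopLevel

end
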